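import Mathlib.LinearAlgebra.Matrix.Rank
import Mathlib.LinearAlgebra.FiniteDimensional.Lemmas
import Mathlib.Logic.Relation
import Mathlib.Tactic
import HarnessLib

/-!
# Crux `ThetaLayerLambdaCongruenceAtTwo` (stmt-BirchSwinnertonDyer-20688, route ResidualThetaTransportAtTwo), line
# `birth` v9, plan ITEM B1' (lead rtt-p3 g3, `Lines/birth-C3k-plan.md`): the CYCLE SPACE of a finite connected quiver has
# dimension `#E − #V + 1` over EVERY field (width seat bsd-wall-rtt-p3-w3 g2; `--supports stmt-BirchSwinnertonDyer-20688
# --as helper`; closes nothing)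

HONEST FRAMING. Generic linear algebra of a finite quiver (no definition, no instance); nothing about any curve or form is
asserted; BSD is not proved by any of this.

WHAT. The lead's reformulation of ITEM B1 («the integral Manin-symbol module modulo the S-fixed and τ-fixed cosets is torsion-free»)
is a statement about the graph `G'` of `τ`-orbits (vertices) and free `S`-orbits (edges) of `Γ₀(N')\SL₂(ℤ)`: the symbol
systems of (C3k) form its cycle space `Z₁(G'; k)`, and what is needed is `dim_k Z₁(G'; k) = #E − #V + 1` for EVERY field
`k` (characteristic `2` included — where Laplacian/positivity arguments are unavailable). This file proves the generic
statement for a quiver given by two maps `s t : E → V` between finite types (loops and multiple edges allowed), `V`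
non-empty, CONNECTED in the combinatorial sense (the equivalence relation generated by `s e ~ t e` is total):
* `quiver_eq_of_forall_apply_eq` — a potential `f : V → k` with `f (t e) = f (s e)` for all `e` is constant;
* `quiver_transpose_mulVec_apply` / `quiver_mulVec_apply` — the coboundary `δ f (e) = f(t e) − f(s e)` and the boundary
  `∂ M (v) = Σ_{t e = v} M e − Σ_{s e = v} M e` are `Bᵀ.mulVec`, `B.mulVec` for the incidence matrix
  `B v e = [t e = v] − [s e = v]` (written with `Matrix.of`, no definition);
* `quiver_ker_coboundary_eq_span_one` — `ker δ = k·𝟙`;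
* **`quiver_finrank_cycleSpace_add_card`** — `finrank_k (ker ∂) + #V = #E + 1` (rank–nullity twice + `rank Bᵀ = rank B`).

References: [Manin1972] Thm. 1.9 (Manin symbols; where the statement is used); J.-P. Serre, Trees, §I.2 (graphs, circuits).
-/

-- justification: the `Summit.BirchSwinnertonDyer.BirchSwinnertonDyer.…` path repeats a component (route-file convention)
set_option linter.dupNamespace false

namespace Summit.BirchSwinnertonDyer.BirchSwinnertonDyer.Theorems.ThetaLayerLambdaCongruenceAtTwo

section Quiver

variable {E V : Type*} [Fintype E] [Fintype V] [DecidableEq V] {k : Type*} [Field k] (s t : E → V)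

omit [Fintype E] [Fintype V] [DecidableEq V] in
/-- **Potentials on a connected quiver are constant**: if `f (t e) = f (s e)` for every edge `e` and the equivalence
relation generated by the edges is total, then `f v = f w`. [folklore] -/
theorem quiver_eq_of_forall_apply_eq (hconn : ∀ v w : V, Relation.EqvGen (fun a b ↦ ∃ e, s e = a ∧ t e = b) v w)
    {R : Type*} (f : V → R) (hf : ∀ e, f (t e) = f (s e)) (v w : V) : f v = f w := by
  induction hconn v w with
  | rel a b h =>
    obtain ⟨e, hs, ht⟩ := h
    rw [← hs, ← ht, hf]
  | refl a => rfl
  | symm a b _ ih => exact ih.symm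
  | trans a b c _ _ ih₁ ih₂ => exact ih₁.trans ih₂

omit [Fintype E] in
/-- The coboundary: `(Bᵀ f)(e) = f(t e) − f(s e)` for the incidence matrix `B v e = [t e = v] − [s e = v]`. [folklore] -/
theorem quiver_transpose_mulVec_apply (f : V → k) (e : E) :
    (Matrix.of (fun (v : V) (e : E) ↦ ((if t e = v then (1 : k) else 0) - (if s e = v then (1 : k) else 0)))).transpose.mulVec
      f e = f (t e) - f (s e) := by
  simp only [Matrix.mulVec, dotProduct, Matrix.transpose_apply, Matrix.of_apply, sub_mul, Finset.sum_sub_distrib,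
    ite_mul, one_mul, zero_mul, Finset.sum_ite_eq, Finset.mem_univ, if_true]

omit [Fintype V] in
/-- The boundary: `(B M)(v) = Σ_{t e = v} M e − Σ_{s e = v} M e`. [folklore] -/
theorem quiver_mulVec_apply (M : E → k) (v : V) :
    (Matrix.of (fun (v : V) (e : E) ↦ ((if t e = v then (1 : k) else 0) - (if s e = v then (1 : k) else 0)))).mulVec M v =
      (∑ e ∈ Finset.univ.filter (fun e ↦ t e = v), M e) - ∑ e ∈ Finset.univ.filter (fun e ↦ s e = v), M e := by
  simp only [Matrix.mulVec, dotProduct, Matrix.of_apply, sub_mul, Finset.sum_sub_distrib, ite_mul, one_mul, zero_mul,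
    Finset.sum_filter]

omit [Fintype E] in
/-- **`ker δ = k·𝟙`** on a connected quiver. [folklore] -/
theorem quiver_ker_coboundary_eq_span_one
    (hconn : ∀ v w : V, Relation.EqvGen (fun a b ↦ ∃ e, s e = a ∧ t e = b) v w) :
    LinearMap.ker (Matrix.of (fun (v : V) (e : E) ↦
        ((if t e = v then (1 : k) else 0) - (if s e = v then (1 : k) else 0)))).transpose.mulVecLin =
      k ∙ (fun _ : V ↦ (1 : k)) := by
  ext f
  rw [LinearMap.mem_ker, Submodule.mem_span_singleton, Matrix.mulVecLin_apply]
  constructor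
  · intro hf
    have hf' : ∀ e, f (t e) = f (s e) := fun e ↦ by
      have := congrFun hf e
      rw [quiver_transpose_mulVec_apply, Pi.zero_apply] at this
      exact sub_eq_zero.mp this
    rcases isEmpty_or_nonempty V with hV | ⟨⟨v₀⟩⟩
    · exact ⟨0, funext fun v ↦ (hV.false v).elim⟩
    · refine ⟨f v₀, funext fun v ↦ ?_⟩
      rw [Pi.smul_apply, smul_eq_mul, mul_one]
      exact quiver_eq_of_forall_apply_eq s t hconn f hf' v₀ v
  · rintro ⟨a, rfl⟩
    funext e
    rw [quiver_transpose_mulVec_apply, Pi.zero_apply, Pi.smul_apply, Pi.smul_apply, sub_self]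

/-- **THE CYCLE SPACE OF A FINITE CONNECTED QUIVER HAS DIMENSION `#E − #V + 1` OVER EVERY FIELD**:
`finrank_k ker(∂) + #V = #E + 1`, `∂ M (v) = Σ_{t e = v} M e − Σ_{s e = v} M e` (here as `B.mulVecLin` for the incidence
matrix `B`). Rank–nullity for `∂` and for the coboundary `δ = Bᵀ` (whose kernel is the constants), and `rank Bᵀ = rank B`.
No positivity, no characteristic assumption. [folklore; cite: Manin1972, Thm. 1.9 (where it is used)] -/
theorem quiver_finrank_cycleSpace_add_card [Nonempty V]
    (hconn : ∀ v w : V, Relation.EqvGen (fun a b ↦ ∃ e, s e = a ∧ t e = b) v w) :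
    Module.finrank k (LinearMap.ker (Matrix.of (fun (v : V) (e : E) ↦
        ((if t e = v then (1 : k) else 0) - (if s e = v then (1 : k) else 0)))).mulVecLin) + Fintype.card V =
      Fintype.card E + 1 := by
  set B : Matrix V E k := Matrix.of (fun (v : V) (e : E) ↦
    ((if t e = v then (1 : k) else 0) - (if s e = v then (1 : k) else 0))) with hB
  -- rank–nullity for `∂ = B.mulVecLin : (E → k) → (V → k)`
  have h1 : B.rank + Module.finrank k (LinearMap.ker B.mulVecLin) = Fintype.card E := by
    rw [Matrix.rank, LinearMap.finrank_range_add_finrank_ker, Module.finrank_fintype_fun_eq_card]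
  -- rank–nullity for `δ = Bᵀ.mulVecLin : (V → k) → (E → k)`, whose kernel is the line of constants
  have h2 : B.transpose.rank + 1 = Fintype.card V := by
    have h := LinearMap.finrank_range_add_finrank_ker B.transpose.mulVecLin
    rw [Module.finrank_fintype_fun_eq_card, hB, quiver_ker_coboundary_eq_span_one s t hconn,
      finrank_span_singleton (by exact fun h0 ↦ one_ne_zero (congrFun h0 (Classical.arbitrary V)))] at h
    rw [Matrix.rank, hB]
    exact h
  rw [Matrix.rank_transpose] at h2
  omega

/-- **The incidence matrix of a finite connected quiver has rank `#V − 1` over every field**: `rank B + 1 = #V`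
(so `dim coker δ = dim ker ∂ = #E − #V + 1` is FIELD-INDEPENDENT — the form in which "no `2`-torsion in the integral
cokernel" is used). [folklore; cite: Manin1972, Thm. 1.9 (where it is used)] -/
theorem quiver_rank_incidence_add_one [Nonempty V]
    (hconn : ∀ v w : V, Relation.EqvGen (fun a b ↦ ∃ e, s e = a ∧ t e = b) v w) :
    (Matrix.of (fun (v : V) (e : E) ↦ ((if t e = v then (1 : k) else 0) - (if s e = v then (1 : k) else 0)))).rank + 1 =
      Fintype.card V := by
  set B : Matrix V E k := Matrix.of (fun (v : V) (e : E) ↦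
    ((if t e = v then (1 : k) else 0) - (if s e = v then (1 : k) else 0))) with hB
  have h := LinearMap.finrank_range_add_finrank_ker B.transpose.mulVecLin
  rw [Module.finrank_fintype_fun_eq_card, hB, quiver_ker_coboundary_eq_span_one s t hconn,
    finrank_span_singleton (by exact fun h0 ↦ one_ne_zero (congrFun h0 (Classical.arbitrary V)))] at h
  rw [← Matrix.rank_transpose, Matrix.rank, hB]
  exact h

/-- **The range of the boundary map has codimension `1`**: `finrank (range ∂) + 1 = #V` (the image of `∂` is the
hyperplane of weight-zero vertex functions). [folklore] -/
theorem quiver_finrank_range_boundary_add_one [Nonempty V]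
    (hconn : ∀ v w : V, Relation.EqvGen (fun a b ↦ ∃ e, s e = a ∧ t e = b) v w) :
    Module.finrank k (LinearMap.range (Matrix.of (fun (v : V) (e : E) ↦
        ((if t e = v then (1 : k) else 0) - (if s e = v then (1 : k) else 0)))).mulVecLin) + 1 = Fintype.card V :=
  quiver_rank_incidence_add_one s t hconn

end Quiver

/-! ## Connectivity of Schreier graphs (for the `S`/`τ`-orbit graph of `Γ₀(N)\SL₂(ℤ)`) -/

section Schreier

/-- **Schreier graphs of transitive actions are connected**: if a group `G` acts transitively on `X` and is generated by
`gens`, then the equivalence relation generated by `a ~ σ • a` (`σ ∈ gens`) is total. [folklore] -/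
theorem eqvGen_smul_of_closure_eq_top {G X : Type*} [Group G] [MulAction G X] {gens : Set G}
    (hgen : Subgroup.closure gens = ⊤) (htrans : ∀ x y : X, ∃ g : G, g • x = y) (x y : X) :
    Relation.EqvGen (fun a b ↦ ∃ σ ∈ gens, σ • a = b) x y := by
  obtain ⟨g, rfl⟩ := htrans x y
  have hg : g ∈ Subgroup.closure gens := by rw [hgen]; exact Subgroup.mem_top g
  induction hg using Subgroup.closure_induction generalizing x with
  | mem σ hσ => exact Relation.EqvGen.rel _ _ ⟨σ, hσ, rfl⟩
  | one => rw [one_smul]; exact Relation.EqvGen.refl _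
  | mul a b _ _ iha ihb =>
    rw [mul_smul]
    exact (ihb x).trans _ _ _ (iha (b • x))
  | inv a _ iha =>
    have h := iha (a⁻¹ • x)
    rw [smul_inv_smul] at h
    exact h.symm _ _

end Schreier

end Summit.BirchSwinnertonDyer.BirchSwinnertonDyer.Theorems.ThetaLayerLambdaCongruenceAtTwo
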